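import Mathlib
import Summits.NavierStokesRegularity.NavierStokesRegularity.Theorems.EulerZoomLiouvillePowerGaugeEulerLiouvilleCondenserSharpCrossings
import Summits.NavierStokesRegularity.NavierStokesRegularity.Theorems.EulerZoomLiouvillePowerGaugeEulerLiouvilleCondenserCircleMeanCore
import Summits.NavierStokesRegularity.NavierStokesRegularity.Theorems.EulerZoomLiouvillePowerGaugeEulerLiouvilleCondenserWeightedQuietSliceShell

/-!
# (B″) THE SHELL CONDENSER, STATIC FORM (nsreg-p2 g36 ROUND-46 «THE KINEMATIC CEILING» §1, plate t48-B″ — static half)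

Width piece for crux `EulerZoomLiouville.PowerGaugeEulerLiouville` (stmt-NavierStokesRegularity-19832), by name under LEAD 19832
(ns-typeII-p2 g13); seat ns-sfl-p1 g7, `--supports stmt-NavierStokesRegularity-19832 --as helper`.  Text = nsreg-p2 g36's
`r46/Sketch46.lean` (sha16 7c4c548940e39666) Prop `NsregP2.R46.ShellCondenser` binder-for-binder (`E3` spelled out).

This is t47-B′'s static form `Condenser.exists_slice_alternative_of_crossings` (p669915) rebuilt for a WINDOW of heights
`[ℓ₁, ℓ₂]`, crossing points of norm `≤ ℓ₂`, a free disc radius `r`, an outer radius `R' > ℓ₂ + r`, the Dirichlet ENERGY BUDGET ON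
THE SHELL `B(0,R') ∩ {ℓ₁ ≤ ‖x‖}` only (every slice disc `D̄(y_s, r) ⊂ {⟪x,e⟫ = s}` has `‖x‖ ≥ s ≥ ℓ₁`), and the circle-mean
smallness `√(2X/(πη(ℓ₂−ℓ₁)))/r ≤ δγℓ₁` carried as a HYPOTHESIS (it kills the first branch of the core since `δ < 1/2`, and gives
`(1−δ)γs − B ≥ (1−2δ)γs`).  At the (Q″) height `s` the core exponent is
`2π((1−2δ)γs)²·((ℓ₁+(1−η)(ℓ₂−ℓ₁))³−ℓ₁³)/(3 S s²)`: THE HEIGHT CANCELS, so the conclusion reads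
`(δγℓ₁/r)·exp(2π((1−2δ)γ)²((ℓ₁+(1−η)(ℓ₂−ℓ₁))³−ℓ₁³)/(3S)) ≤ G`.

Both planar/slicing plates enter BY NAME: (C) = `Condenser.circleMeanCondenserCore_of` (t47-C, p669142, ns-ezl-w2 g4) and
(Q″) = `Condenser.weightedQuietSliceShell_of` (t48-Q″, p678007); (X) = `…CondenserComplexChart`; the rotation `e ↦ e₂` and the
rotation invariance of the budgets as in t47-B′ (`exists_linearIsometryEquiv_apply_eq`, `setIntegral_ball_comp_linearIsometryEquiv`,
here also `setIntegral_ballShell_comp_linearIsometryEquiv` for the shell), and `{ℓ₁ ≤ x 2} ⊆ {ℓ₁ ≤ ‖x‖}` for slab ≤ shell.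

* `shellCondenser_of` — the static shell condenser with implicit binders;
* `shellCondenser` — `NsregP2.R46.ShellCondenser` VERBATIM.

HONEST FRAMING: real analysis in `ℝ³`; nothing here proves the crux E (19832 OPEN), any door Target, or any Navier–Stokes
statement; no summit statement is touched. [folklore (length–area method); cite: ConstantinIgnatovaVicol2026Putative, §3.4.1
for the setting]
-/

noncomputable section

open Set Filter Topology Metric Function MeasureTheory Real
open scoped RealInnerProductSpace

set_option linter.dupNamespace false

namespace Summit.NavierStokesRegularity.NavierStokesRegularity.Theorems.PowerGaugeEulerLiouville.Condenser

open Literature.Analysis Literature.Analysis.FluidPDE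

/-! ## Shell and slab budgets -/

/-- Shell integrals `∫_{B(0,r) ∩ {ℓ ≤ ‖x‖}}` are invariant under precomposition with a linear isometry. [folklore] -/
theorem setIntegral_ballShell_comp_linearIsometryEquiv (G : EuclideanSpace ℝ (Fin 3) → ℝ)
    (Rot : EuclideanSpace ℝ (Fin 3) ≃ₗᵢ[ℝ] EuclideanSpace ℝ (Fin 3)) (r ℓ : ℝ) :
    ∫ x in ball (0 : EuclideanSpace ℝ (Fin 3)) r ∩ {x | ℓ ≤ ‖x‖}, G (Rot.symm x) =
      ∫ x in ball (0 : EuclideanSpace ℝ (Fin 3)) r ∩ {x | ℓ ≤ ‖x‖}, G x := by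
  have h := Rot.symm.measurePreserving.setIntegral_preimage_emb Rot.symm.toHomeomorph.measurableEmbedding G
    (ball (0 : EuclideanSpace ℝ (Fin 3)) r ∩ {x | ℓ ≤ ‖x‖})
  have hpre : (Rot.symm : EuclideanSpace ℝ (Fin 3) → EuclideanSpace ℝ (Fin 3)) ⁻¹'
      (ball (0 : EuclideanSpace ℝ (Fin 3)) r ∩ {x | ℓ ≤ ‖x‖}) = ball 0 r ∩ {x | ℓ ≤ ‖x‖} := by
    ext x; simp [mem_ball, dist_zero_right]
  rw [hpre] at h
  exact h

/-- SLAB ≤ SHELL: for a continuous `G ≥ 0`, `∫_{B(0,r) ∩ {ℓ ≤ x₂}} G ≤ ∫_{B(0,r) ∩ {ℓ ≤ ‖x‖}} G`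
(`x 2 ≤ ‖x‖`). [folklore] -/
theorem setIntegral_ballSlab_le_ballShell {G : EuclideanSpace ℝ (Fin 3) → ℝ} (hGc : Continuous G)
    (hG0 : ∀ x, 0 ≤ G x) (r ℓ : ℝ) :
    ∫ x in ball (0 : EuclideanSpace ℝ (Fin 3)) r ∩ {x | ℓ ≤ x 2}, G x ≤
      ∫ x in ball (0 : EuclideanSpace ℝ (Fin 3)) r ∩ {x | ℓ ≤ ‖x‖}, G x := by
  have hint : IntegrableOn G (ball (0 : EuclideanSpace ℝ (Fin 3)) r ∩ {x | ℓ ≤ ‖x‖}) volume :=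
    (hGc.continuousOn.integrableOn_compact (isCompact_closedBall 0 r)).mono_set
      (inter_subset_left.trans ball_subset_closedBall)
  refine setIntegral_mono_set hint (ae_of_all _ fun x => hG0 x) (ae_of_all _ ?_)
  intro x hx
  refine ⟨hx.1, ?_⟩
  have h2 : x 2 ≤ ‖x‖ := by
    have he₂ : ‖EuclideanSpace.basisFun (Fin 3) ℝ 2‖ = 1 := (EuclideanSpace.basisFun (Fin 3) ℝ).orthonormal.1 2
    have h := abs_real_inner_le_norm x (EuclideanSpace.basisFun (Fin 3) ℝ 2)
    rw [EuclideanSpace.inner_basisFun_real, he₂, mul_one] at h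
    exact (le_abs_self _).trans h
  exact le_trans hx.2 h2

/-! ## The shell condenser, static form -/

set_option maxHeartbeats 400000 in
/-- **(B″) THE SHELL CONDENSER, STATIC FORM.**  See the module docstring.  [folklore (length–area method);
cite: ConstantinIgnatovaVicol2026Putative, §3.4.1 for the setting] -/
theorem shellCondenser_of {V : EuclideanSpace ℝ (Fin 3) → EuclideanSpace ℝ (Fin 3)} (hV : ContDiff ℝ 1 V)
    {e : EuclideanSpace ℝ (Fin 3)} (he : ‖e‖ = 1)
    {γ ℓ₁ ℓ₂ r R' η δ X S G : ℝ} (hγ : 0 < γ) (hℓ₁ : 0 < ℓ₁) (hℓ : ℓ₁ < ℓ₂) (hr : 0 < r) (hR' : ℓ₂ + r < R')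
    (hη : 0 < η) (hη1 : η < 1) (hδ : 0 < δ) (hδ2 : δ < 1 / 2) (hX : 0 < X) (hS : 0 < S)
    (hA : ∫ x in ball (0 : EuclideanSpace ℝ (Fin 3)) R', ‖V x‖ ^ 2 ≤ X)
    (hE : ∫ x in ball (0 : EuclideanSpace ℝ (Fin 3)) R' ∩ {x | ℓ₁ ≤ ‖x‖}, ‖fderiv ℝ V x‖ ^ 2 ≤ S)
    (hG : ∀ z ∈ ball (0 : EuclideanSpace ℝ (Fin 3)) R', ‖fderiv ℝ V z‖ ≤ G)
    (hsmall : Real.sqrt (2 * (X / (η * (ℓ₂ - ℓ₁))) / Real.pi) / r ≤ δ * (γ * ℓ₁))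
    (hcross : ∀ s ∈ Icc ℓ₁ ℓ₂,
      ∃ y₁ : EuclideanSpace ℝ (Fin 3), ⟪y₁, e⟫ = s ∧ ‖y₁‖ ≤ ℓ₂ ∧ γ * s ≤ ‖V y₁‖) :
    δ * (γ * ℓ₁) / r *
        Real.exp (2 * Real.pi * ((1 - 2 * δ) * γ) ^ 2 *
          (((ℓ₁ + (1 - η) * (ℓ₂ - ℓ₁)) ^ 3 - ℓ₁ ^ 3) / (3 * S))) ≤ G := by
  -- rotate `e` to `e₂`
  set e₂ : EuclideanSpace ℝ (Fin 3) := EuclideanSpace.basisFun (Fin 3) ℝ 2 with he₂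
  have he₂1 : ‖e₂‖ = 1 := (EuclideanSpace.basisFun (Fin 3) ℝ).orthonormal.1 2
  obtain ⟨Rot, hRot⟩ := exists_linearIsometryEquiv_apply_eq he he₂1
  -- the rotated field
  set W : EuclideanSpace ℝ (Fin 3) → EuclideanSpace ℝ (Fin 3) := fun z => V (Rot.symm z) with hW
  have hWc : ContDiff ℝ 1 W := hV.comp Rot.symm.toContinuousLinearEquiv.contDiff
  have hWd : Differentiable ℝ W := hWc.differentiable one_ne_zero
  have hDW : ∀ x, ‖fderiv ℝ W x‖ = ‖fderiv ℝ V (Rot.symm x)‖ := norm_fderiv_comp_linearIsometryEquiv V Rot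
  have hDWc : Continuous fun x => ‖fderiv ℝ W x‖ ^ 2 := ((hWc.continuous_fderiv one_ne_zero).norm.pow 2)
  -- budgets for `W`: ball (amplitude), shell ⊇ slab (energy)
  have hA' : ∫ x in ball (0 : EuclideanSpace ℝ (Fin 3)) R', ‖W x‖ ^ 2 ≤ X := by
    have h := setIntegral_ball_comp_linearIsometryEquiv (fun x => ‖V x‖ ^ 2) Rot R'
    simp only [hW]
    rw [h]; exact hA
  have hE' : ∫ x in ball (0 : EuclideanSpace ℝ (Fin 3)) R' ∩ {x | ℓ₁ ≤ ‖x‖}, ‖fderiv ℝ W x‖ ^ 2 ≤ S := by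
    have h := setIntegral_ballShell_comp_linearIsometryEquiv (fun x => ‖fderiv ℝ V x‖ ^ 2) Rot R' ℓ₁
    simp_rw [hDW]
    rw [h]; exact hE
  have hEslab : ∫ x in ball (0 : EuclideanSpace ℝ (Fin 3)) R' ∩ {x | ℓ₁ ≤ x 2}, ‖fderiv ℝ W x‖ ^ 2 ≤ S :=
    (setIntegral_ballSlab_le_ballShell hDWc (fun x => sq_nonneg _) R' ℓ₁).trans hE'
  -- the weighted quiet slice on the window, slab budget (t48-Q″)
  obtain ⟨s, hs, hFs, hGs⟩ := weightedQuietSliceShell_of (F := fun x => ‖W x‖ ^ 2)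
    (G := fun x => ‖fderiv ℝ W x‖ ^ 2) (hWc.continuous.norm.pow 2) hDWc (fun x => sq_nonneg _)
    (fun x => sq_nonneg _) hℓ₁ hℓ hη hη1 hX hS hA' hEslab
  have hsℓ : ℓ₁ ≤ s := hs.1
  have hspos : 0 < s := hℓ₁.trans_le hsℓ
  -- the anomalous point on it, rotated
  obtain ⟨y₁, hy₁e, hy₁n, hy₁V⟩ := hcross s hs
  set y₁' : EuclideanSpace ℝ (Fin 3) := Rot y₁ with hy₁'
  have hy₁'2 : y₁' 2 = s := by
    rw [← EuclideanSpace.inner_basisFun_real (x := y₁') (i := 2), ← he₂, hy₁', ← hRot, Rot.inner_map_map, hy₁e]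
  have hy₁'n : ‖y₁'‖ ≤ ℓ₂ := by rw [hy₁', Rot.norm_map]; exact hy₁n
  have hm : 0 < γ * s := mul_pos hγ hspos
  have hWy : γ * s ≤ ‖W y₁'‖ := by
    have h2 : W y₁' = V y₁ := by simp [hW, hy₁']
    rw [h2]; exact hy₁V
  have hWy0 : 0 < ‖W y₁'‖ := hm.trans_le hWy
  -- the unit vector `u = W y₁' / ‖W y₁'‖`
  set u : EuclideanSpace ℝ (Fin 3) := (‖W y₁'‖⁻¹ : ℝ) • W y₁' with hu
  have hu1 : ‖u‖ = 1 := by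
    rw [hu, norm_smul, norm_inv, norm_norm, inv_mul_cancel₀ hWy0.ne']
  -- the scalar through the `ℂ`-chart at `y₁'`
  set ψ : ℂ → ℝ := fun z =>
    ⟪W (y₁' + z.re • EuclideanSpace.basisFun (Fin 3) ℝ 0 + z.im • EuclideanSpace.basisFun (Fin 3) ℝ 1), u⟫ with hψ
  have hψc : ContDiff ℝ 1 ψ := contDiff_comp_cchart (f := fun x => ⟪W x, u⟫) (hWc.inner ℝ contDiff_const) y₁'
  have hψ0 : γ * s ≤ ψ 0 := by
    have h0 : ψ 0 = ‖W y₁'‖ := by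
      simp only [hψ, Complex.zero_re, Complex.zero_im, zero_smul, add_zero]
      rw [hu]; exact inner_self_normalize _
    rw [h0]; exact hWy
  -- the disc `|z| ≤ r` around `y₁'` fits in `B(0,R')`
  have hfit : ‖y₁'‖ + r < R' := by linarith
  -- gradient bound on the disc
  have hGψ : ∀ z ∈ closedBall (0 : ℂ) r, ‖fderiv ℝ ψ z‖ ≤ G := by
    intro z hz
    have h1 := norm_fderiv_inner_comp_cchart_le hWd hu1.le y₁' z
    refine h1.trans ?_
    rw [hDW]
    apply hG
    rw [mem_ball, dist_zero_right, Rot.symm.norm_map]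
    rw [mem_closedBall, dist_zero_right] at hz
    exact (norm_cchart_le y₁' z).trans_lt (by linarith)
  -- disc budgets from the slice budgets
  set A : ℝ := X / (η * (ℓ₂ - ℓ₁)) with hAdef
  set D : ℝ := (ℓ₁ + (1 - η) * (ℓ₂ - ℓ₁)) ^ 3 - ℓ₁ ^ 3 with hDdef
  have hAψ : ∫ z in closedBall (0 : ℂ) r, ψ z ^ 2 ≤ A := by
    have h := setIntegral_cdisc_sq_inner_le hWc hu1.le hfit
    rw [hy₁'2] at h
    exact h.trans hFs
  have hEψ : ∫ z in closedBall (0 : ℂ) r, ‖fderiv ℝ ψ z‖ ^ 2 ≤ 3 * S / D * s ^ 2 := by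
    have h := setIntegral_cdisc_sq_norm_fderiv_inner_le hWc hu1.le hfit
    rw [hy₁'2] at h
    exact h.trans hGs
  -- the slice energy budget is positive
  have hbase : ℓ₁ < ℓ₁ + (1 - η) * (ℓ₂ - ℓ₁) := by nlinarith
  have hD : 0 < D := by
    have h2 := pow_lt_pow_left₀ hbase hℓ₁.le (n := 3) (by norm_num)
    rw [hDdef]; linarith
  have hEs : 0 < 3 * S / D * s ^ 2 := by positivity
  -- the circular-mean core (t47-C)
  have hcore := circleMeanCondenserCore_of hψc hm hψ0 hr hδ hEs hGψ hAψ hEψ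
  -- the outer-mean term `B ≤ δγℓ₁ ≤ δγs`
  set B : ℝ := Real.sqrt (2 * A / Real.pi) / r with hBdef
  have hBs : B ≤ δ * (γ * s) := by
    have h1 : δ * (γ * ℓ₁) ≤ δ * (γ * s) :=
      mul_le_mul_of_nonneg_left (mul_le_mul_of_nonneg_left hsℓ hγ.le) hδ.le
    exact hsmall.trans h1
  rcases hcore with h | h
  · -- the small-drop branch is impossible since `δ < 1/2`
    exfalso
    nlinarith
  · -- the exponential branch: prefactor and exponent are monotone in `s ≥ ℓ₁`; the height cancels
    have hpre : δ * (γ * ℓ₁) / r ≤ δ * (γ * s) / r :=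
      div_le_div_of_nonneg_right (mul_le_mul_of_nonneg_left (mul_le_mul_of_nonneg_left hsℓ hγ.le) hδ.le) hr.le
    have hlow0 : 0 ≤ (1 - 2 * δ) * γ * s := by
      have : 0 ≤ 1 - 2 * δ := by linarith
      positivity
    have hlow : (1 - 2 * δ) * γ * s ≤ (1 - δ) * (γ * s) - B := by linarith
    have hsq : ((1 - 2 * δ) * γ * s) ^ 2 ≤ ((1 - δ) * (γ * s) - B) ^ 2 := pow_le_pow_left₀ hlow0 hlow 2
    have hDS : D / (3 * S) * (3 * S / D) = 1 := by
      rw [div_mul_div_comm, mul_comm D (3 * S), div_self (ne_of_gt (by positivity))]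
    have hexpo : 2 * Real.pi * ((1 - 2 * δ) * γ) ^ 2 * (D / (3 * S)) ≤
        2 * Real.pi * ((1 - δ) * (γ * s) - B) ^ 2 / (3 * S / D * s ^ 2) := by
      rw [le_div_iff₀ hEs]
      calc 2 * Real.pi * ((1 - 2 * δ) * γ) ^ 2 * (D / (3 * S)) * (3 * S / D * s ^ 2)
          = 2 * Real.pi * ((1 - 2 * δ) * γ * s) ^ 2 * (D / (3 * S) * (3 * S / D)) := by ring
        _ = 2 * Real.pi * ((1 - 2 * δ) * γ * s) ^ 2 := by rw [hDS, mul_one]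
        _ ≤ 2 * Real.pi * ((1 - δ) * (γ * s) - B) ^ 2 := mul_le_mul_of_nonneg_left hsq (by positivity)
    have hexp := Real.exp_le_exp.2 hexpo
    have hb0 : 0 ≤ δ * (γ * s) / r := div_nonneg (mul_nonneg hδ.le (mul_nonneg hγ.le hspos.le)) hr.le
    have hstep := mul_le_mul hpre hexp (Real.exp_pos _).le hb0
    exact hstep.trans h

/-- **`NsregP2.R46.ShellCondenser`, binder-for-binder** (Sketch46 of nsreg-p2 g36, sha16 7c4c548940e39666, plate t48-B″ static;
`E3` spelled out). [folklore (length–area method); cite: ConstantinIgnatovaVicol2026Putative, §3.4.1 for the setting] -/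
theorem shellCondenser :
    ∀ (V : EuclideanSpace ℝ (Fin 3) → EuclideanSpace ℝ (Fin 3)), ContDiff ℝ 1 V →
      ∀ (e : EuclideanSpace ℝ (Fin 3)), ‖e‖ = 1 →
        ∀ (γ ℓ₁ ℓ₂ r R' η δ X S G : ℝ), 0 < γ → 0 < ℓ₁ → ℓ₁ < ℓ₂ → 0 < r → ℓ₂ + r < R' → 0 < η → η < 1 →
          0 < δ → δ < 1 / 2 → 0 < X → 0 < S →
          (∫ x in ball (0 : EuclideanSpace ℝ (Fin 3)) R', ‖V x‖ ^ 2 ≤ X) →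
          (∫ x in ball (0 : EuclideanSpace ℝ (Fin 3)) R' ∩ {x : EuclideanSpace ℝ (Fin 3) | ℓ₁ ≤ ‖x‖},
              ‖fderiv ℝ V x‖ ^ 2 ≤ S) →
          (∀ z ∈ ball (0 : EuclideanSpace ℝ (Fin 3)) R', ‖fderiv ℝ V z‖ ≤ G) →
          Real.sqrt (2 * (X / (η * (ℓ₂ - ℓ₁))) / Real.pi) / r ≤ δ * (γ * ℓ₁) →
          (∀ s ∈ Icc ℓ₁ ℓ₂, ∃ y₁ : EuclideanSpace ℝ (Fin 3), ⟪y₁, e⟫ = s ∧ ‖y₁‖ ≤ ℓ₂ ∧ γ * s ≤ ‖V y₁‖) →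
          δ * (γ * ℓ₁) / r *
              Real.exp (2 * Real.pi * ((1 - 2 * δ) * γ) ^ 2 *
                (((ℓ₁ + (1 - η) * (ℓ₂ - ℓ₁)) ^ 3 - ℓ₁ ^ 3) / (3 * S))) ≤ G :=
  fun _ hV _ he _ _ _ _ _ _ _ _ _ _ hγ hℓ₁ hℓ hr hR' hη hη1 hδ hδ2 hX hS hA hE hG hsmall hcross =>
    shellCondenser_of hV he hγ hℓ₁ hℓ hr hR' hη hη1 hδ hδ2 hX hS hA hE hG hsmall hcross

end Summit.NavierStokesRegularity.NavierStokesRegularity.Theorems.PowerGaugeEulerLiouville.Condenser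

end
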